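import Mathlib
import HarnessLib
import Summits.PneNP.PneNP.Theorems.CnfIdealGenLengthRankDefectRepresentationsFiniteStability
import Summits.PneNP.PneNP.Theorems.CnfIdealGenLengthRankDefectRepresentationsSortingLemma

/-!
# Uniform rank-stability of `Z_2^n` with a FINITE constant for every `n` (line rank-dehn-ladder, negative rung N0b)

Crux `stmt-PneNP-18923` (`Summit.PneNP.PneNP.Theses.CnfIdealGenLength.RankDefectRepresentations`), line
`rank-dehn-ladder`.  The registered stub `stub_uniformStability` (whose proof REFUTES the crux, p607059) asks for uniform
("multiplication-table", Ulam) rank-stability of the elementary abelian group `Z_2^n = (2^{[n]}, △)` with a constant POLYNOMIAL in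
`n`.  This file proves the same statement with SOME finite constant `C_n` for every `n` — the literal shape of the registered stub
with `n^a` replaced by `C_n`:

* `uniformStability_finite` — for every `n` there is `C` such that every `ρ : 2^{[n]} → K^{d×d}` (char 0) with `ρ ∅ = 1` and
  `rank (ρ S ρ T − ρ (S △ T)) ≤ δ` for all `S, T` is within rank `C · δ`, uniformly in `S`, of a genuine representation `π`
  (`π ∅ = 1`, `π S π T = π (S △ T)`).

This is the rank-stability of `Z_2^n` of [Bauer–Blachar–Greenfeld, IMRN 2025, Thm 5.1; bib BauerBlacharGreenfeld2025] in Ulam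
form, kernel-checked with an unoptimised constant; so the item-deciding question N0b is EXACTLY the growth rate of the optimal `C_n`
(polynomial ⟹ ¬crux).  Proof: the letters `U_i = ρ{i}` are almost involutions with pairwise commutators of rank `≤ 2δ`; the almost
idempotents `(1 − U_i)/2` are exactified (`…OrthogonalFamilyStability.orthogonalFamily_stable`, cost `27δ`), made commuting by the
landed finite stability `…FiniteStability.stub_finiteStability` (p618152), turned back into commuting involutions `V_i`, and
`π S := ∏_{i ∈ S↑} V_i` (sorted products) is a genuine representation by the landed sorting lemma (p606832) at `t = 0`;
`rank (ρ S − π S) ≤ n·δ + n · max_i rank (U_i − V_i)` by almost-multiplicativity of `ρ` along the sorted word and telescoping.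
HONEST FRAMING: calibration of the negative rung (finite constant, not polynomial); the crux and P ≠ NP are not touched; F-N2 is a
FRONTIER formal rung.
-/

set_option linter.dupNamespace false -- `Summit.PneNP.PneNP.…`: summit = sub-problem name (D-0017)

namespace Summit.PneNP.PneNP.Theorems.CnfIdealGenLengthRankDefectRepresentationsUniformStabilityFinite

open Finset
open Literature.Computability.AlgebraicComplexity (rank_add_le rank_smul_le)
open Summit.PneNP.PneNP.Theorems.CnfIdealGenLengthRankDefectRepresentationsTseitinTransfer (rk_neg rk_sub)
open Summit.PneNP.PneNP.Theorems.CnfIdealGenLengthRankDefectRepresentationsOrthogonalFamilyStability (orthogonalFamily_stable)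
open Summit.PneNP.PneNP.Theorems.CnfIdealGenLengthRankDefectRepresentationsFiniteStability (stub_finiteStability)
open Summit.PneNP.PneNP.Theorems.CnfIdealGenLengthRankDefectRepresentationsSortingLemma (stub_sortingLemma)

variable {K : Type} [Field K] {n d : ℕ}

/-! ## Small matrix facts -/

/-- A matrix of rank `0` is `0`. [folklore] -/
theorem eq_zero_of_rank_eq_zero (A : Matrix (Fin d) (Fin d) K) (h : A.rank = 0) : A = 0 := by
  have h1 : LinearMap.range A.mulVecLin = ⊥ := Submodule.finrank_eq_zero.mp h
  have h2 : A.mulVecLin = 0 := LinearMap.range_eq_bot.mp h1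
  ext i j
  have h3 := congrFun (congrArg (fun f : (Fin d → K) →ₗ[K] (Fin d → K) => f (Pi.single j 1)) h2) i
  simpa [Matrix.mulVecLin_apply, Matrix.mulVec_single_one] using h3

/-- Exactification of an almost idempotent with constant `27` (char 0), via the `K^{b+1}`-stability theorem with `b = 1`
(route-independent import; the constant-`1` Fitting lemma lives in a route-dependent module). [folklore] -/
theorem exists_idempotent_near27 [CharZero K] (A : Matrix (Fin d) (Fin d) K) (s : ℕ) (hA : (A * A - A).rank ≤ s) :
    ∃ E : Matrix (Fin d) (Fin d) K, E * E = E ∧ (E - A).rank ≤ 27 * s := by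
  set r : Fin 2 → Matrix (Fin d) (Fin d) K := ![1 - A, A] with hr
  have hr0 : r 0 = 1 - A := rfl
  have hr1 : r 1 = A := rfl
  have hidem : ∀ l, (r l * r l - r l).rank ≤ s := by
    intro l; fin_cases l
    · show ((1 - A) * (1 - A) - (1 - A)).rank ≤ s
      have e : (1 - A) * (1 - A) - (1 - A) = A * A - A := by noncomm_ring
      rw [e]; exact hA
    · exact hA
  have horth : ∀ l m, l ≠ m → (r l * r m).rank ≤ s := by
    intro l m hlm
    fin_cases l <;> fin_cases m
    · exact absurd rfl hlm
    · show ((1 - A) * A).rank ≤ s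
      have e : (1 - A) * A = -(A * A - A) := by noncomm_ring
      rw [e, rk_neg]; exact hA
    · show (A * (1 - A)).rank ≤ s
      have e : A * (1 - A) = -(A * A - A) := by noncomm_ring
      rw [e, rk_neg]; exact hA
    · exact absurd rfl hlm
  have hone : (∑ l, r l - 1).rank ≤ s := by
    rw [Fin.sum_univ_two, hr0, hr1, sub_add_cancel, sub_self, Matrix.rank_zero]; exact Nat.zero_le _
  obtain ⟨Q, hQ1, -, -, hQd⟩ := orthogonalFamily_stable r s hidem horth hone
  refine ⟨Q 1, hQ1 1, ?_⟩
  have := hQd 1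
  have e : 3 * (1 + 2) ^ 2 * s = 27 * s := by ring
  rw [hr1, e] at this
  exact this

/-- Almost-multiplicativity of `ρ` along a duplicate-free word: `rank (ρ (l.toFinset) − ∏_{a ∈ l} ρ{a}) ≤ |l| · δ`. -/
theorem rank_rho_sub_lprod_le (ρ : Finset (Fin n) → Matrix (Fin d) (Fin d) K) (δ : ℕ) (hρ0 : ρ ∅ = 1)
    (hρ : ∀ S T : Finset (Fin n), (ρ S * ρ T - ρ (symmDiff S T)).rank ≤ δ) :
    ∀ l : List (Fin n), l.Nodup → (ρ l.toFinset - (l.map fun a => ρ {a}).prod).rank ≤ l.length * δ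
  | [], _ => by simp [hρ0]
  | a :: l, hal => by
      rw [List.nodup_cons] at hal
      have ih := rank_rho_sub_lprod_le ρ δ hρ0 hρ l hal.2
      have hal' : a ∉ l.toFinset := by simpa using hal.1
      have hins : (a :: l).toFinset = symmDiff {a} l.toFinset := by
        rw [List.toFinset_cons]
        ext x
        simp only [Finset.mem_insert, Finset.mem_symmDiff, Finset.mem_singleton]
        constructor
        · rintro (rfl | hx)
          · exact Or.inl ⟨rfl, hal'⟩
          · exact Or.inr ⟨hx, fun h => hal' (h ▸ hx)⟩
        · rintro (⟨h1, -⟩ | ⟨h1, -⟩)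
          · exact Or.inl h1
          · exact Or.inr h1
      rw [hins, List.map_cons, List.prod_cons, List.length_cons]
      have e : ρ (symmDiff {a} l.toFinset) - ρ {a} * (l.map fun a => ρ {a}).prod =
          -(ρ {a} * ρ l.toFinset - ρ (symmDiff {a} l.toFinset)) +
            ρ {a} * (ρ l.toFinset - (l.map fun a => ρ {a}).prod) := by noncomm_ring
      rw [e]
      refine (rank_add_le _ _).trans ?_
      rw [rk_neg]
      have h1 := hρ {a} l.toFinset
      have h2 := (Matrix.rank_mul_le_right (ρ {a}) (ρ l.toFinset - (l.map fun a => ρ {a}).prod)).trans ih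
      have : (l.length + 1) * δ = δ + l.length * δ := by ring
      rw [this]
      exact Nat.add_le_add h1 h2

/-- Telescoping along a word: `rank (∏ U_a − ∏ V_a) ≤ |l| · max_a rank (U_a − V_a)`. [folklore] -/
theorem rank_lprod_sub_lprod_le (U V : Fin n → Matrix (Fin d) (Fin d) K) (m : ℕ) (hm : ∀ i, (U i - V i).rank ≤ m) :
    ∀ l : List (Fin n), ((l.map U).prod - (l.map V).prod).rank ≤ l.length * m
  | [] => by simp
  | a :: l => by
      have ih := rank_lprod_sub_lprod_le U V m hm l
      rw [List.map_cons, List.map_cons, List.prod_cons, List.prod_cons, List.length_cons]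
      have e : U a * (l.map U).prod - V a * (l.map V).prod =
          (U a - V a) * (l.map U).prod + V a * ((l.map U).prod - (l.map V).prod) := by noncomm_ring
      rw [e]
      refine (rank_add_le _ _).trans ?_
      have h1 := (Matrix.rank_mul_le_left (U a - V a) (l.map U).prod).trans (hm a)
      have h2 := (Matrix.rank_mul_le_right (V a) ((l.map U).prod - (l.map V).prod)).trans ih
      have : (l.length + 1) * m = m + l.length * m := by ring
      rw [this]
      exact Nat.add_le_add h1 h2

/-- The sorted word of `S` (letters of `S` in increasing order) is duplicate-free, has `S` as its set of letters, and
has length `≤ n`. -/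
theorem sortedWord_props (S : Finset (Fin n)) :
    ((List.finRange n).filter (· ∈ S)).Nodup ∧ ((List.finRange n).filter (· ∈ S)).toFinset = S ∧
      ((List.finRange n).filter (· ∈ S)).length ≤ n := by
  refine ⟨(List.nodup_finRange n).filter _, ?_, ?_⟩
  · ext x; simp
  · exact (List.length_filter_le _ _).trans (by simp)

/-! ## The theorem -/

/-- **Uniform rank-stability of `Z_2^n` with a finite constant, for every `n`** (Ulam form of [BauerBlacharGreenfeld2025,
Thm 5.1] for the elementary abelian `2`-group; the registered `stub_uniformStability` asks for `C = n^a`). -/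
theorem uniformStability_finite :
    ∀ n : ℕ, ∃ C : ℕ, ∀ (K : Type) [Field K] [CharZero K] (d δ : ℕ)
      (ρ : Finset (Fin n) → Matrix (Fin d) (Fin d) K), ρ ∅ = 1 →
      (∀ S T : Finset (Fin n), (ρ S * ρ T - ρ (symmDiff S T)).rank ≤ δ) →
      ∃ π : Finset (Fin n) → Matrix (Fin d) (Fin d) K, π ∅ = 1 ∧
        (∀ S T : Finset (Fin n), π S * π T = π (symmDiff S T)) ∧
        ∀ S : Finset (Fin n), (ρ S - π S).rank ≤ C * δ := by
  intro n
  obtain ⟨Cn, hCn⟩ := stub_finiteStability n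
  refine ⟨n * (28 + 190 * Cn), fun K _ _ d δ ρ hρ0 hρ => ?_⟩
  classical
  -- Step 1: the letters are almost involutions with small commutators
  set U : Fin n → Matrix (Fin d) (Fin d) K := fun i => ρ {i} with hU_def
  have hU2 : ∀ i, (U i * U i - 1).rank ≤ δ := by
    intro i
    have h := hρ {i} {i}
    rwa [symmDiff_self, Finset.bot_eq_empty, hρ0] at h
  have hUc : ∀ i j, (U i * U j - U j * U i).rank ≤ 2 * δ := by
    intro i j
    have hsd : symmDiff ({j} : Finset (Fin n)) {i} = symmDiff {i} {j} := symmDiff_comm _ _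
    have h1 := hρ {i} {j}
    have h2 := hρ {j} {i}
    rw [hsd] at h2
    have e : U i * U j - U j * U i =
        (ρ {i} * ρ {j} - ρ (symmDiff {i} {j})) + -(ρ {j} * ρ {i} - ρ (symmDiff {i} {j})) := by
      simp only [hU_def]; abel
    rw [e]
    refine (rank_add_le _ _).trans ?_
    rw [rk_neg]
    omega
  -- Step 2: almost idempotents `A_i = (1 - U_i)/2`, exactified
  have h2 : (2 : K) ≠ 0 := two_ne_zero
  set A : Fin n → Matrix (Fin d) (Fin d) K := fun i => (2 : K)⁻¹ • (1 - U i) with hA_def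
  have hUA : ∀ i, U i = 1 - (2 : K) • A i := by
    intro i
    show U i = 1 - (2 : K) • ((2 : K)⁻¹ • (1 - U i))
    rw [smul_smul, mul_inv_cancel₀ h2, one_smul, sub_sub_cancel]
  have hc2 : (2 : K)⁻¹ * (2 : K)⁻¹ * (2 : K) = (2 : K)⁻¹ := by field_simp
  have hAB : ∀ i, ∃ B : Matrix (Fin d) (Fin d) K, B = 1 - U i ∧ A i = (2 : K)⁻¹ • B := fun i => ⟨_, rfl, rfl⟩
  have hAdef : ∀ i, (A i * A i - A i).rank ≤ δ := by
    intro i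
    obtain ⟨B, hB, hAi⟩ := hAB i
    have eU : B * B - (2 : K) • B = U i * U i - 1 := by rw [hB, two_smul]; noncomm_ring
    have e : A i * A i - A i = ((2 : K)⁻¹ * (2 : K)⁻¹) • (U i * U i - 1) := by
      rw [← eU, smul_sub, smul_smul, hc2, hAi, smul_mul_smul_comm]
    rw [e]
    exact (rank_smul_le _ _).trans (hU2 i)
  have hEx : ∀ i, ∃ E : Matrix (Fin d) (Fin d) K, E * E = E ∧ (E - A i).rank ≤ 27 * δ :=
    fun i => exists_idempotent_near27 (A i) δ (hAdef i)
  choose E hE hEA using hEx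
  -- Step 3: commutators of the exact idempotents
  have hAc : ∀ i j, (A i * A j - A j * A i).rank ≤ 2 * δ := by
    intro i j
    obtain ⟨B, hB, hAi⟩ := hAB i
    obtain ⟨B', hB', hAj⟩ := hAB j
    have eU : B * B' - B' * B = U i * U j - U j * U i := by rw [hB, hB']; noncomm_ring
    have e : A i * A j - A j * A i = ((2 : K)⁻¹ * (2 : K)⁻¹) • (U i * U j - U j * U i) := by
      rw [← eU, smul_sub, hAi, hAj, smul_mul_smul_comm, smul_mul_smul_comm]
    rw [e]
    exact (rank_smul_le _ _).trans (hUc i j)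
  have hEc : ∀ i j, (E i * E j - E j * E i).rank ≤ 190 * δ := by
    intro i j
    set Di := E i - A i with hDi
    set Dj := E j - A j with hDj
    have hi : E i = A i + Di := by rw [hDi]; abel
    have hj : E j = A j + Dj := by rw [hDj]; abel
    have e : E i * E j - E j * E i =
        (A i * A j - A j * A i) + (Di * E j + -(E j * Di)) + (A i * Dj + -(Dj * A i)) := by
      rw [hi, hj]; noncomm_ring
    rw [e]
    have h1 := hEA i; have h2 := hEA j
    rw [← hDi] at h1; rw [← hDj] at h2
    have r0 := rank_add_le (A i * A j - A j * A i + (Di * E j + -(E j * Di))) (A i * Dj + -(Dj * A i))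
    have r1 := rank_add_le (A i * A j - A j * A i) (Di * E j + -(E j * Di))
    have r2 := rank_add_le (Di * E j) (-(E j * Di))
    have r3 := rank_add_le (A i * Dj) (-(Dj * A i))
    have e1 : (Di * E j).rank ≤ 27 * δ := (Matrix.rank_mul_le_left _ _).trans h1
    have e2 : (-(E j * Di)).rank ≤ 27 * δ := by rw [rk_neg]; exact (Matrix.rank_mul_le_right _ _).trans h1
    have e3 : (A i * Dj).rank ≤ 27 * δ := (Matrix.rank_mul_le_right _ _).trans h2
    have e4 : (-(Dj * A i)).rank ≤ 27 * δ := by rw [rk_neg]; exact (Matrix.rank_mul_le_left _ _).trans h2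
    have e0 := hAc i j
    omega
  -- Step 4: finite stability
  obtain ⟨E', hE'1, hE'2, hdist⟩ := hCn K d (190 * δ) E hE hEc
  -- Step 5: commuting involutions and their sorted products
  set V : Fin n → Matrix (Fin d) (Fin d) K := fun i => 1 - (2 : K) • E' i with hV_def
  have hV2 : ∀ i, V i * V i = 1 := by
    intro i
    show (1 - (2 : K) • E' i) * (1 - (2 : K) • E' i) = 1
    have h4 : ((2 : K) • E' i) * ((2 : K) • E' i) = (4 : K) • E' i := by
      rw [smul_mul_smul_comm, hE'1 i]; norm_num
    simp only [sub_mul, mul_sub, one_mul, mul_one, h4]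
    module
  have hVc : ∀ i j, (V i * V j - V j * V i).rank ≤ 0 := by
    intro i j
    have e : V i * V j - V j * V i = 0 := by
      show (1 - (2 : K) • E' i) * (1 - (2 : K) • E' j) - (1 - (2 : K) • E' j) * (1 - (2 : K) • E' i) = 0
      simp only [sub_mul, mul_sub, smul_mul_smul_comm, one_mul, mul_one, hE'2 i j]
      abel
    rw [e, Matrix.rank_zero]
  set π : Finset (Fin n) → Matrix (Fin d) (Fin d) K :=
    fun S => (((List.finRange n).filter (· ∈ S)).map V).prod with hπ_def
  have hπ0 : π ∅ = 1 := by
    simp [hπ_def]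
  have hπmul : ∀ S T, π S * π T = π (symmDiff S T) := by
    intro S T
    have h := stub_sortingLemma K n d 0 V hV2 hVc S T
    rw [Nat.mul_zero, Nat.le_zero] at h
    have h0 := eq_zero_of_rank_eq_zero _ h
    exact sub_eq_zero.mp h0
  refine ⟨π, hπ0, hπmul, fun S => ?_⟩
  -- Step 6: distance along the sorted word of `S`
  obtain ⟨hnd, hset, hlen⟩ := sortedWord_props S
  set l := (List.finRange n).filter (· ∈ S) with hl
  have hUV : ∀ i, (U i - V i).rank ≤ (27 + 190 * Cn) * δ := by
    intro i
    have e : U i - V i = (2 : K) • ((E' i - E i) + (E i - A i)) := by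
      rw [hUA i]; simp only [hV_def, smul_add, smul_sub]; abel
    rw [e]
    refine (rank_smul_le _ _).trans ((rank_add_le _ _).trans ?_)
    have h1 : (E' i - E i).rank ≤ Cn * (190 * δ) := by rw [← rk_neg, neg_sub]; exact hdist i
    have h2 := hEA i
    have : (27 + 190 * Cn) * δ = Cn * (190 * δ) + 27 * δ := by ring
    rw [this]
    exact Nat.add_le_add h1 h2
  have hA1 : (ρ S - (l.map U).prod).rank ≤ n * δ := by
    have h := rank_rho_sub_lprod_le ρ δ hρ0 hρ l hnd
    rw [hset] at h
    exact h.trans (Nat.mul_le_mul_right δ hlen)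
  have hA2 : ((l.map U).prod - (l.map V).prod).rank ≤ n * ((27 + 190 * Cn) * δ) :=
    (rank_lprod_sub_lprod_le U V _ hUV l).trans (Nat.mul_le_mul_right _ hlen)
  have e : ρ S - π S = (ρ S - (l.map U).prod) + ((l.map U).prod - (l.map V).prod) := by
    simp only [hπ_def, hl]; abel
  rw [e]
  refine (rank_add_le _ _).trans ?_
  have : n * (28 + 190 * Cn) * δ = n * δ + n * ((27 + 190 * Cn) * δ) := by ring
  rw [this]
  exact Nat.add_le_add hA1 hA2

end Summit.PneNP.PneNP.Theorems.CnfIdealGenLengthRankDefectRepresentationsUniformStabilityFinite
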